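import Summits.Ventures.CertifiedManyBodySolver.Certificates.HubbardSquare_n7o8_stripeStar_dictionary
import Summits.Ventures.CertifiedManyBodySolver.Certificates.HubbardSquare_n7o8_corr_lroGc_rows258_262
import Summits.Ventures.CertifiedManyBodySolver.Certificates.HubbardSquare_n7o8_corr_lroGs_rows259_263
import HarnessLib
import HarnessLib.Audit

/-!
# Ventures/CertifiedManyBodySolver — Certificates/HubbardSquare_n7o8_stripeStar_instances.lean

HONEST FRAMING: first certified bounds; not a superconductivity verdict; every number certified or labelled float.

**G2 Stage 2 (S2b + S2c) for the stripe-order kernel ceilings** of CERTIFIED.md rows #262/#258 (charge, `t′ = 0 / −1/4`)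
and #263/#259 (spin, `t′ = 0 / −1/4`): the DICTIONARY lemmas and the BY-NAME VENTURE-SIDE INSTANCES that turn m3-4's
measure-level theorems `Observables/StripeOrderKernelCeiling.lean` (`chargeStar_braggWeight_le_r262/_r258`,
`spinStar_braggWeight_le_r263/_r259`, `neel_braggWeight_le_r263/_r259` — theorems about an arbitrary finite measure `μ`
representing an arbitrary lattice function `C` with real-number side conditions) into theorems about the thermodynamic-limit
states of the certified rows.  Spec: pub-mbboot-lit g33 (INBOX 2026-08-21T18:59:51Z) + m3-4 g8 typing notes; S2a
(`IsTranslationInvariant.isPositiveDefinite_corr`, Herglotz) is the LANDED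
`Literature/MathematicalPhysics/QuantumLattice/InfVolFermionStateCorrelationPositiveDefinite.lean`.

`Certificates/HubbardSquare_n7o8_stripeStar_dictionary.lean` holds the charge dictionary; this file adds the SPIN
dictionary and the six instances.

## The objects

* `spinCorr ω v = Re ω_{{0,v}}(𝐒_0·𝐒_v)` (the currency of `Rows/TLSpinStar`), `spinnn = ½(C(e₁)+C(e₂))`,
  `spinnnn = ½(C(e₁+e₂)+C(e₂−e₁))`; the **D₄-orbit-mean spin correlation**
  `spinOrbitCorr ω r = 8⁻¹ Σ_γ Σ_α ω((S^α_0)⋆ · τ_{γr} S^α_0)` (`spinCorrSum`, in the `S⁺,S⁻,S^z` basis).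
* Both orbit means are `IsPositiveDefinite` for translation-invariant `ω`, hence each HAS a representing finite
  measure (`chargeOrbitCorr_representable`, `spinOrbitCorr_representable`, Herglotz) — the non-vacuity companions.

## The dictionary (S2b, spin)

  (`fermionSpinDot_self`); `spinCorr ω (−v) = spinCorr ω v`; `spinGsB = −(3/2) n_{0↑}n_{0↓} − (𝐒_0·𝐒_{e₁} + 𝐒_0·𝐒_{e₂})
  + ½(𝐒_0·𝐒_{e₁+e₂} + 𝐒_0·𝐒_{e₂−e₁})` (`spinGsB_eq`), so the row's orbit mean is `−(3/2) docc − 2 spinnn + spinnnn`.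

## The instances (S2c)

`chargeStar_r262_instance`, `chargeStar_r258_instance`, `spinStar_r263_instance`, `neel_r263_instance`,
`spinStar_r259_instance`, `neel_r259_instance`: hypotheses = the claim nodes of the row (`hup`, `hE`) + the state binders of
`m3_lroGc_*_uncond_of` / `m3_lroGs_*_uncond_of` VERBATIM + a finite measure `μ` representing `chargeOrbitCorr ω`
(resp. `spinOrbitCorr ω`); conclusion = the Bragg-weight ceiling of record.  NOTE (stronger than the spec): the spec asked
for two extra state hypotheses (translation invariance, one-site density `7/8`); both are CONSEQUENCES of the typed sector
hypotheses (`m3_rowState_invariances`, Rows/DopedTLSpinStar.lean: a torus limit is translation invariant and its density is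
the sector filling), so they are derived, not assumed.  Nothing here asserts a bound without its claim nodes as hypotheses,
and a CEILING on a Bragg weight says nothing about the presence of stripe order.

Zero compute; no new numerics; no sorry.
-/

noncomputable section

namespace Summit.Ventures.CertifiedManyBodySolver.Certificates

open Literature.MathematicalPhysics.QuantumLattice
open Literature.MathematicalPhysics.QuantumLattice.ThermodynamicLimit
open Literature.Probability.LatticeModels
open Filter Topology HubbardWave0 Literature.MathematicalPhysics.QuantumManyBody.StateRelaxation
open Summit.HubbardSuperconductivity.ManyBodyBootstrap.Bounds
open Summit.Ventures.CertifiedManyBodySolver.SpinStarTL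
open Literature.MathematicalPhysics.QuantumLattice.FermionSpinMoment
open scoped Matrix BigOperators

open Summit.Ventures.CertifiedManyBodySolver.Transport

section SpinDictionary

variable {ω : InfVolFermionState 2}

/-- The spin–spin two-point function `C_ω(v) = Re ω_{{0,v}}(𝐒_0·𝐒_v)` (the currency of `Rows/TLSpinStar`). -/
def spinCorr (ω : InfVolFermionState 2) (v : Site 2) : ℝ :=
  (ω.expect {0, v} (spinDotAt 0 (Finset.mem_insert_self 0 {v}) v
    (Finset.mem_insert_of_mem (Finset.mem_singleton_self v)))).re

/-- `Σ_α ω((S^α_0)⋆ · τ_v S^α_0)` in the `S⁺, S⁻, S^z` basis: `½ ω(S⁻_0 τ_v S⁺_0) + ½ ω(S⁺_0 τ_v S⁻_0) + ω(S^z_0 τ_v S^z_0)`. -/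
def spinCorrSum (ω : InfVolFermionState 2) (v : Site 2) : ℂ :=
  ((1/2 : ℝ) : ℂ) * ω.corr (sPlusAt 0 (Finset.mem_singleton_self 0))ᴴ
      (fermionEmbed (PolySite.shiftEmb v {0}) (sPlusAt 0 (Finset.mem_singleton_self 0))) +
    ((1/2 : ℝ) : ℂ) * ω.corr (sMinusAt 0 (Finset.mem_singleton_self 0))ᴴ
      (fermionEmbed (PolySite.shiftEmb v {0}) (sMinusAt 0 (Finset.mem_singleton_self 0))) +
    ω.corr (sZAt 0 (Finset.mem_singleton_self 0))ᴴ
      (fermionEmbed (PolySite.shiftEmb v {0}) (sZAt 0 (Finset.mem_singleton_self 0)))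

/-- `spinCorrSum ω` is positive definite for translation-invariant `ω` (three one-site S2a terms). -/
theorem isPositiveDefinite_spinCorrSum (hω : ω.IsTranslationInvariant) :
    Literature.Analysis.FunctionSpaces.IsPositiveDefinite (spinCorrSum ω) := by
  have h : (0 : ℝ) ≤ 1/2 := by norm_num
  exact (((hω.isPositiveDefinite_corr_oneSite (sPlusAt 0 (Finset.mem_singleton_self 0))).real_smul h).add
    ((hω.isPositiveDefinite_corr_oneSite (sMinusAt 0 (Finset.mem_singleton_self 0))).real_smul h)).add
    (hω.isPositiveDefinite_corr_oneSite (sZAt 0 (Finset.mem_singleton_self 0)))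

/-- `spinCorrSum ω v = ω_{{0,v}}(𝐒_0·𝐒_v)`. -/
theorem spinCorrSum_eq (v : Site 2) :
    spinCorrSum ω v = ω.expect {0, v} (spinDotAt 0 (Finset.mem_insert_self 0 {v}) v
      (Finset.mem_insert_of_mem (Finset.mem_singleton_self v))) := by
  have h₁ : ({0} : Finset (Site 2)) ⊆ {0, v} := Finset.singleton_subset_iff.2 (Finset.mem_insert_self 0 {v})
  have h₂ : shiftSet v ({0} : Finset (Site 2)) ⊆ {0, v} :=
    (shiftSet_singleton_zero_subset' v).trans
      (Finset.singleton_subset_iff.2 (Finset.mem_insert_of_mem (Finset.mem_singleton_self v)))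
  rw [spinCorrSum, ω.corr_eq_expect_of_subset h₁ h₂, ω.corr_eq_expect_of_subset h₁ h₂,
    ω.corr_eq_expect_of_subset h₁ h₂]
  simp only [sPlusAt, sMinusAt, sZAt, spinDotAt, conjTranspose_fermionSpinPlus, conjTranspose_fermionSpinMinus,
    conjTranspose_fermionSpinZ, fermionEmbed_fermionSpinPlus, fermionEmbed_fermionSpinMinus,
    fermionEmbed_fermionSpinZ, PolySite.shiftEmb_pt, PolySite.incl_pt]
  rw [pt_congr' (zero_add v) _ (Finset.mem_insert_of_mem (Finset.mem_singleton_self v)), fermionSpinDot,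
    map_add, map_smul, map_add, smul_eq_mul]
  push_cast
  ring

/-- `Re spinCorrSum ω v = spinCorr ω v`. -/
theorem re_spinCorrSum (v : Site 2) : (spinCorrSum ω v).re = spinCorr ω v := by
  rw [spinCorrSum_eq, spinCorr]

/-- `spinCorr ω 0 = ¾(ρ − 2·docc ω)` (from `fermionSpinDot_self`). -/
theorem spinCorr_zero (hω : ω.IsTranslationInvariant) : spinCorr ω 0 = 3/4 * (ω.density - 2 * docc ω) := by
  rw [spinCorr, spinDotAt, fermionSpinDot_self, map_smul, smul_eq_mul,
    show (3/4 : ℂ) = ((3/4 : ℝ) : ℂ) by norm_num, Complex.re_ofReal_mul, re_expect_localMoment_eq hω, docc]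

/-- `spinCorr ω (−v) = spinCorr ω v`. -/
theorem spinCorr_neg (hω : ω.IsTranslationInvariant) (v : Site 2) : spinCorr ω (-v) = spinCorr ω v :=
  corr_neg hω v

/-- `spinCorr` respects equality of sites. -/
theorem spinCorr_congr {v w : Site 2} (h : v = w) : spinCorr ω v = spinCorr ω w := by subst h; rfl

/-- `Re ω_Λ(𝐒_x·𝐒_y) = spinCorr ω (y − x)` for translation-invariant `ω`. -/
theorem re_expect_fermionSpinDot_eq_spinCorr (hω : ω.IsTranslationInvariant) {Λ : Finset (Site 2)}
    (x y : PolySite Λ) : (ω.expect Λ (fermionSpinDot x y)).re = spinCorr ω (ofLex y.1 - ofLex x.1) :=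
  re_expect_fermionSpinDot_eq_corr hω x y

/-- The `D₄`-averaged spin correlation `C_s(r) = 8⁻¹ Σ_γ Σ_α ω(S^α_0 · τ_{γr} S^α_0)`. -/
def spinOrbitCorr (ω : InfVolFermionState 2) (r : Site 2) : ℂ :=
  (((8 : ℝ)⁻¹ : ℝ) : ℂ) * ∑ g : DihedralGroup 4, spinCorrSum ω (d4Vec g r)

/-- `spinOrbitCorr ω` is positive definite for translation-invariant `ω` (S2a + the `D₄` orbit mean). -/
theorem isPositiveDefinite_spinOrbitCorr (hω : ω.IsTranslationInvariant) :
    Literature.Analysis.FunctionSpaces.IsPositiveDefinite (spinOrbitCorr ω) := by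
  have h1 : ∀ g : DihedralGroup 4, Literature.Analysis.FunctionSpaces.IsPositiveDefinite
      (fun r : Site 2 => spinCorrSum ω (d4Vec g r)) := fun g =>
    isPositiveDefinite_comp_d4Vec (isPositiveDefinite_spinCorrSum hω) g
  have h2 := Literature.Analysis.FunctionSpaces.IsPositiveDefinite.sum Finset.univ (fun g _ => h1 g)
  exact h2.real_smul (r := (8 : ℝ)⁻¹) (by norm_num)

/-- `Re spinOrbitCorr ω r = 8⁻¹ Σ_γ spinCorr ω (γr)`. -/
private theorem spinOrbitCorr_re_eq (r : Site 2) :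
    (spinOrbitCorr ω r).re = (8 : ℝ)⁻¹ * ∑ g : DihedralGroup 4, spinCorr ω (d4Vec g r) := by
  rw [spinOrbitCorr, Complex.re_ofReal_mul, Complex.re_sum]
  congr 1
  exact Finset.sum_congr rfl fun g _ => re_spinCorrSum _

/-- `spinnn = ½ (C_ω(e₁) + C_ω(e₂))`. -/
def spinnn (ω : InfVolFermionState 2) : ℝ := (1/2) * (spinCorr ω ![1, 0] + spinCorr ω ![0, 1])
/-- `spinnnn = ½ (C_ω(e₁+e₂) + C_ω(e₂−e₁))`. -/
def spinnnn (ω : InfVolFermionState 2) : ℝ := (1/2) * (spinCorr ω ![1, 1] + spinCorr ω ![-1, 1])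

/-- `![-1, 0] = -![1, 0]`. -/
theorem neg_e1 : (![-1, 0] : Site 2) = -![1, 0] := by decide
/-- `![0, -1] = -![0, 1]`. -/
theorem neg_e2 : (![0, -1] : Site 2) = -![0, 1] := by decide
/-- `![-1, -1] = -![1, 1]`. -/
theorem neg_d1 : (![-1, -1] : Site 2) = -![1, 1] := by decide
/-- `![1, -1] = -![-1, 1]`. -/
theorem neg_d3 : (![1, -1] : Site 2) = -![-1, 1] := by decide

/-- `Re spinOrbitCorr ω 0 = ¾(7/8 − 2·docc ω)`. -/
theorem spinOrbitCorr_re_zero (hω : ω.IsTranslationInvariant) (hn : ω.density = 7/8) :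
    (spinOrbitCorr ω ![0, 0]).re = 3/4 * (7/8 - 2 * docc ω) := by
  have h0 : (![0, 0] : Site 2) = 0 := by decide
  rw [spinOrbitCorr_re_eq, d4_sum_zero (spinCorr ω), h0, spinCorr_zero hω, hn]
  ring
/-- `Re spinOrbitCorr ω e₁ = spinnn ω`. -/
theorem spinOrbitCorr_re_e1 (hω : ω.IsTranslationInvariant) : (spinOrbitCorr ω ![1, 0]).re = spinnn ω := by
  rw [spinOrbitCorr_re_eq, d4_sum_e1 (spinCorr ω), neg_e1, neg_e2, spinCorr_neg hω, spinCorr_neg hω, spinnn]; ring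
/-- `Re spinOrbitCorr ω e₂ = spinnn ω`. -/
theorem spinOrbitCorr_re_e2 (hω : ω.IsTranslationInvariant) : (spinOrbitCorr ω ![0, 1]).re = spinnn ω := by
  rw [spinOrbitCorr_re_eq, d4_sum_e2 (spinCorr ω), neg_e1, neg_e2, spinCorr_neg hω, spinCorr_neg hω, spinnn]; ring
/-- `Re spinOrbitCorr ω (e₁+e₂) = spinnnn ω`. -/
theorem spinOrbitCorr_re_d1 (hω : ω.IsTranslationInvariant) : (spinOrbitCorr ω ![1, 1]).re = spinnnn ω := by
  rw [spinOrbitCorr_re_eq, d4_sum_d1 (spinCorr ω), neg_d1, neg_d3, spinCorr_neg hω, spinCorr_neg hω, spinnnn]; ring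
/-- `Re spinOrbitCorr ω (e₁−e₂) = spinnnn ω`. -/
theorem spinOrbitCorr_re_d2 (hω : ω.IsTranslationInvariant) : (spinOrbitCorr ω ![1, -1]).re = spinnnn ω := by
  rw [spinOrbitCorr_re_eq, d4_sum_d2 (spinCorr ω), neg_d1, neg_d3, spinCorr_neg hω, spinCorr_neg hω, spinnnn]; ring

/-- `Re ω(Γ(γ) G_s) = −(3/2) docc − (C_ω(γe₁) + C_ω(γe₂)) + ½ (C_ω(γ(e₁+e₂)) + C_ω(γ(e₂−e₁)))`. -/
theorem re_expect_d4_spinGsB (hω : ω.IsTranslationInvariant) (g : DihedralGroup 4) :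
    (ω.expect (d4ShiftSet g 0 gsSupportB) (fermionEmbed (PolySite.d4Emb g 0 gsSupportB) spinGsB)).re =
      -(3/2) * docc ω - (spinCorr ω (d4Vec g (unitVec 0)) + spinCorr ω (d4Vec g (unitVec 1))) +
        1/2 * (spinCorr ω (d4Vec g (unitVec 0 + unitVec 1)) + spinCorr ω (d4Vec g (unitVec 1 - unitVec 0))) := by
  rw [spinGsB_eq]
  simp only [spinDotAt, nAt, map_add, map_smul, map_mul, fermionEmbed_numberOp, fermionEmbed_fermionSpinDot, d4Emb_pt,
    smul_eq_mul, Complex.add_re]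
  push_cast
  rw [show (-3/2 : ℂ) = ((-3/2 : ℝ) : ℂ) by norm_num, show (-1 : ℂ) = ((-1 : ℝ) : ℂ) by norm_num,
    show (1/2 : ℂ) = ((1/2 : ℝ) : ℂ) by norm_num, Complex.re_ofReal_mul, Complex.re_ofReal_mul,
    Complex.re_ofReal_mul, Complex.add_re, Complex.add_re, re_expect_nAt_mul_nAt_eq_docc hω,
    re_expect_fermionSpinDot_eq_spinCorr hω, re_expect_fermionSpinDot_eq_spinCorr hω,
    re_expect_fermionSpinDot_eq_spinCorr hω, re_expect_fermionSpinDot_eq_spinCorr hω]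
  simp only [PolySite.ofLex_coe_pt, d4Vec_zero, add_zero, sub_zero]
  ring

/-- The row's `D₄`-averaged spin functional bound `≤ q` gives `−(3/2) docc − 2 spinnn + spinnnn ≤ q` (dictionary for the `hrow` hypothesis of the spin-star / Néel ceilings). -/
theorem spin_hrow_of (hω : ω.IsTranslationInvariant) {q : ℝ}
    (h : ((Finset.univ : Finset (DihedralGroup 4)).card : ℝ)⁻¹ *
        ∑ g ∈ (Finset.univ : Finset (DihedralGroup 4)),
          (ω.expect (d4ShiftSet g 0 gsSupportB) (fermionEmbed (PolySite.d4Emb g 0 gsSupportB) spinGsB)).re ≤ q) :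
    -(3/2) * docc ω - 2 * spinnn ω + spinnnn ω ≤ q := by
  simp only [re_expect_d4_spinGsB hω, e1pe2_eq, e2me1_eq] at h
  simp only [unitVec_zero_eq, unitVec_one_eq, Finset.sum_add_distrib,
    Finset.sum_sub_distrib, Finset.sum_const, Finset.card_univ, DihedralGroup.card, nsmul_eq_mul, ← Finset.mul_sum,
    d4_sum_e1 (spinCorr ω), d4_sum_e2 (spinCorr ω), d4_sum_d1 (spinCorr ω), d4_sum_d3 (spinCorr ω)] at h
  rw [neg_e1, neg_e2, neg_d1, neg_d3, spinCorr_neg hω, spinCorr_neg hω, spinCorr_neg hω, spinCorr_neg hω] at h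
  unfold spinnn spinnnn
  push_cast at h
  linarith

end SpinDictionary

section Instances

open MeasureTheory Complex

/-- **Row #262 instance (charge-stripe star, `t′ = 0`)**: for every torus limit `ω` of unit `(rectN (7/8) L, S^z = 0)`-sector
ground states of `hubbardTorusTT' L 1 0 8` and every finite measure `μ` representing `chargeOrbitCorr ω`, the star-averaged
charge Bragg weight is `≤ 0.0468947` — GIVEN the claim nodes of row #262 and of the upper row #166. -/
theorem chargeStar_r262_instance (hup : cert_r262_lro_M3U8tp0_w2_b4_kry1_kry2c3_hop2_LROCup)
    (hE : cert_r166_openbox_32x4_U8_N112_tp0_D1000_b2)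
    (ω : InfVolFermionState 2) (Ls : ℕ → ℕ) (ψ : ∀ L, Fock (Orb (FermionTorus 2 L)))
    (hLs : Tendsto Ls atTop atTop)
    (hψ : ∀ j, IsGroundStateInSector (hubbardTorusTT' (Ls j) 1 0 8) (rectN (7/8) (Ls j)) 0 (ψ (Ls j)))
    (hψ1 : ∀ j, star (ψ (Ls j)) ⬝ᵥ ψ (Ls j) = 1) (hlim : ω.IsTorusLimitOf ψ Ls)
    (μ : Measure (EuclideanSpace ℝ (Fin 2))) [IsFiniteMeasure μ]
    (hμ : ∀ r : Fin 2 → ℤ, ∫ ξ, exp ((∑ i, (r i : ℝ) * ξ i : ℝ) * I) ∂μ = chargeOrbitCorr ω r) :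
    Observables.braggWeight μ Observables.chargeStar / 4 ≤ 0.0468947 := by
  obtain ⟨hω, hn⟩ := m3_rowState_invariances hLs hψ hψ1 hlim
  have hrow := charge_hrow_of hω (m3_lroGc_tp0_r262_uncond_of hup hE ω Ls ψ hLs hψ hψ1 hlim)
  refine Observables.chargeStar_braggWeight_le_r262 μ hμ (chargeOrbitCorr_re_zero hω hn)
    (chargeOrbitCorr_re_e1 hω hn) (chargeOrbitCorr_re_me1 hω hn) (chargeOrbitCorr_re_e2 hω hn)
    (chargeOrbitCorr_re_me2 hω hn) ?_
  refine le_trans hrow (le_of_eq ?_)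
  push_cast
  ring

/-- **Row #258 instance (charge-stripe star, `t′ = −1/4`)**: the same with the claim nodes of rows #258 and #149;
star-averaged charge Bragg weight `≤ 0.0456555`. -/
theorem chargeStar_r258_instance (hup : cert_r258_lro_M3U8tpm1o4_w2_b4_kry1_kry2c3_hop2_LROCup)
    (hE : cert_r149_openbox_16x4_U8_N56_tpm1o4_D1600)
    (ω : InfVolFermionState 2) (Ls : ℕ → ℕ) (ψ : ∀ L, Fock (Orb (FermionTorus 2 L)))
    (hLs : Tendsto Ls atTop atTop)
    (hψ : ∀ j, IsGroundStateInSector (hubbardTorusTT' (Ls j) 1 (-1/4) 8) (rectN (7/8) (Ls j)) 0 (ψ (Ls j)))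
    (hψ1 : ∀ j, star (ψ (Ls j)) ⬝ᵥ ψ (Ls j) = 1) (hlim : ω.IsTorusLimitOf ψ Ls)
    (μ : Measure (EuclideanSpace ℝ (Fin 2))) [IsFiniteMeasure μ]
    (hμ : ∀ r : Fin 2 → ℤ, ∫ ξ, exp ((∑ i, (r i : ℝ) * ξ i : ℝ) * I) ∂μ = chargeOrbitCorr ω r) :
    Observables.braggWeight μ Observables.chargeStar / 4 ≤ 0.0456555 := by
  obtain ⟨hω, hn⟩ := m3_rowState_invariances hLs hψ hψ1 hlim
  have hrow := charge_hrow_of hω (m3_lroGc_tpm1o4_r258_uncond_of hup hE ω Ls ψ hLs hψ hψ1 hlim)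
  refine Observables.chargeStar_braggWeight_le_r258 μ hμ (chargeOrbitCorr_re_zero hω hn)
    (chargeOrbitCorr_re_e1 hω hn) (chargeOrbitCorr_re_me1 hω hn) (chargeOrbitCorr_re_e2 hω hn)
    (chargeOrbitCorr_re_me2 hω hn) ?_
  refine le_trans hrow (le_of_eq ?_)
  push_cast
  ring

/-- **Row #263 instance (spin-stripe star, `t′ = 0`)**: for every torus limit `ω` of the row's sector ground states and every
finite measure `μ` representing `spinOrbitCorr ω`, the star-averaged spin Bragg weight is `≤ 0.0873463` — GIVEN the claim
nodes of row #263 and of the upper row #92. -/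
theorem spinStar_r263_instance (hup : cert_r263_hubSQ_w3_U8_n7o8_R2b4eom_ob5p2_LROSup)
    (hE : cert_r92_luc_ti_upper_tp0_n7o8)
    (ω : InfVolFermionState 2) (Ls : ℕ → ℕ) (ψ : ∀ L, Fock (Orb (FermionTorus 2 L)))
    (hLs : Tendsto Ls atTop atTop)
    (hψ : ∀ j, IsGroundStateInSector (hubbardTorusTT' (Ls j) 1 0 8) (rectN (7/8) (Ls j)) 0 (ψ (Ls j)))
    (hψ1 : ∀ j, star (ψ (Ls j)) ⬝ᵥ ψ (Ls j) = 1) (hlim : ω.IsTorusLimitOf ψ Ls)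
    (μ : Measure (EuclideanSpace ℝ (Fin 2))) [IsFiniteMeasure μ]
    (hμ : ∀ r : Fin 2 → ℤ, ∫ ξ, exp ((∑ i, (r i : ℝ) * ξ i : ℝ) * I) ∂μ = spinOrbitCorr ω r) :
    Observables.braggWeight μ Observables.spinStar / 4 ≤ 0.0873463 := by
  obtain ⟨hω, hn⟩ := m3_rowState_invariances hLs hψ hψ1 hlim
  have hrow := spin_hrow_of hω (m3_lroGs_tp0_r263_uncond_of hup hE ω Ls ψ hLs hψ hψ1 hlim)
  refine Observables.spinStar_braggWeight_le_r263 μ hμ (spinOrbitCorr_re_zero hω hn)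
    (spinOrbitCorr_re_e1 hω) (spinOrbitCorr_re_e2 hω) (spinOrbitCorr_re_d1 hω) (spinOrbitCorr_re_d2 hω) ?_
  refine le_trans hrow (le_of_eq ?_)
  push_cast
  ring

/-- **Row #263 instance (Néel `(π,π)`, `t′ = 0`)**: the `(π,π)` spin Bragg weight is `≤ 0.3360872`. -/
theorem neel_r263_instance (hup : cert_r263_hubSQ_w3_U8_n7o8_R2b4eom_ob5p2_LROSup)
    (hE : cert_r92_luc_ti_upper_tp0_n7o8)
    (ω : InfVolFermionState 2) (Ls : ℕ → ℕ) (ψ : ∀ L, Fock (Orb (FermionTorus 2 L)))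
    (hLs : Tendsto Ls atTop atTop)
    (hψ : ∀ j, IsGroundStateInSector (hubbardTorusTT' (Ls j) 1 0 8) (rectN (7/8) (Ls j)) 0 (ψ (Ls j)))
    (hψ1 : ∀ j, star (ψ (Ls j)) ⬝ᵥ ψ (Ls j) = 1) (hlim : ω.IsTorusLimitOf ψ Ls)
    (μ : Measure (EuclideanSpace ℝ (Fin 2))) [IsFiniteMeasure μ]
    (hμ : ∀ r : Fin 2 → ℤ, ∫ ξ, exp ((∑ i, (r i : ℝ) * ξ i : ℝ) * I) ∂μ = spinOrbitCorr ω r) :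
    Observables.braggWeight μ ![![Real.pi, Real.pi]] ≤ 0.3360872 := by
  obtain ⟨hω, hn⟩ := m3_rowState_invariances hLs hψ hψ1 hlim
  have hrow := spin_hrow_of hω (m3_lroGs_tp0_r263_uncond_of hup hE ω Ls ψ hLs hψ hψ1 hlim)
  refine Observables.neel_braggWeight_le_r263 μ hμ (spinOrbitCorr_re_zero hω hn)
    (spinOrbitCorr_re_e1 hω) (spinOrbitCorr_re_e2 hω) (spinOrbitCorr_re_d1 hω) (spinOrbitCorr_re_d2 hω) ?_
  refine le_trans hrow (le_of_eq ?_)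
  push_cast
  ring

/-- **Row #259 instance (spin-stripe star, `t′ = −1/4`)**: star-averaged spin Bragg weight `≤ 0.0883482`, GIVEN the claim
nodes of rows #259 and #93. -/
theorem spinStar_r259_instance (hup : cert_r259_hubSQ_w3_U8_n7o8_tpm1o4_R2b4eom_ob5p2_LROSup)
    (hE : cert_r93_luc_ti_upper_tpm1o4_n7o8)
    (ω : InfVolFermionState 2) (Ls : ℕ → ℕ) (ψ : ∀ L, Fock (Orb (FermionTorus 2 L)))
    (hLs : Tendsto Ls atTop atTop)
    (hψ : ∀ j, IsGroundStateInSector (hubbardTorusTT' (Ls j) 1 (-1/4) 8) (rectN (7/8) (Ls j)) 0 (ψ (Ls j)))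
    (hψ1 : ∀ j, star (ψ (Ls j)) ⬝ᵥ ψ (Ls j) = 1) (hlim : ω.IsTorusLimitOf ψ Ls)
    (μ : Measure (EuclideanSpace ℝ (Fin 2))) [IsFiniteMeasure μ]
    (hμ : ∀ r : Fin 2 → ℤ, ∫ ξ, exp ((∑ i, (r i : ℝ) * ξ i : ℝ) * I) ∂μ = spinOrbitCorr ω r) :
    Observables.braggWeight μ Observables.spinStar / 4 ≤ 0.0883482 := by
  obtain ⟨hω, hn⟩ := m3_rowState_invariances hLs hψ hψ1 hlim
  have hrow := spin_hrow_of hω (m3_lroGs_tpm1o4_r259_uncond_of hup hE ω Ls ψ hLs hψ hψ1 hlim)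
  refine Observables.spinStar_braggWeight_le_r259 μ hμ (spinOrbitCorr_re_zero hω hn)
    (spinOrbitCorr_re_e1 hω) (spinOrbitCorr_re_e2 hω) (spinOrbitCorr_re_d1 hω) (spinOrbitCorr_re_d2 hω) ?_
  refine le_trans hrow (le_of_eq ?_)
  push_cast
  ring

/-- **Row #259 instance (Néel `(π,π)`, `t′ = −1/4`)**: the `(π,π)` spin Bragg weight is `≤ 0.3399425`. -/
theorem neel_r259_instance (hup : cert_r259_hubSQ_w3_U8_n7o8_tpm1o4_R2b4eom_ob5p2_LROSup)
    (hE : cert_r93_luc_ti_upper_tpm1o4_n7o8)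
    (ω : InfVolFermionState 2) (Ls : ℕ → ℕ) (ψ : ∀ L, Fock (Orb (FermionTorus 2 L)))
    (hLs : Tendsto Ls atTop atTop)
    (hψ : ∀ j, IsGroundStateInSector (hubbardTorusTT' (Ls j) 1 (-1/4) 8) (rectN (7/8) (Ls j)) 0 (ψ (Ls j)))
    (hψ1 : ∀ j, star (ψ (Ls j)) ⬝ᵥ ψ (Ls j) = 1) (hlim : ω.IsTorusLimitOf ψ Ls)
    (μ : Measure (EuclideanSpace ℝ (Fin 2))) [IsFiniteMeasure μ]
    (hμ : ∀ r : Fin 2 → ℤ, ∫ ξ, exp ((∑ i, (r i : ℝ) * ξ i : ℝ) * I) ∂μ = spinOrbitCorr ω r) :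
    Observables.braggWeight μ ![![Real.pi, Real.pi]] ≤ 0.3399425 := by
  obtain ⟨hω, hn⟩ := m3_rowState_invariances hLs hψ hψ1 hlim
  have hrow := spin_hrow_of hω (m3_lroGs_tpm1o4_r259_uncond_of hup hE ω Ls ψ hLs hψ hψ1 hlim)
  refine Observables.neel_braggWeight_le_r259 μ hμ (spinOrbitCorr_re_zero hω hn)
    (spinOrbitCorr_re_e1 hω) (spinOrbitCorr_re_e2 hω) (spinOrbitCorr_re_d1 hω) (spinOrbitCorr_re_d2 hω) ?_
  refine le_trans hrow (le_of_eq ?_)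
  push_cast
  ring

/-- **Non-vacuity of the charge instances**: for translation-invariant `ω` a representing finite measure of
`chargeOrbitCorr ω` EXISTS (Herglotz on `isPositiveDefinite_chargeOrbitCorr`). -/
theorem chargeOrbitCorr_representable (ω : InfVolFermionState 2) (hω : ω.IsTranslationInvariant) :
    ∃ μ : Measure (EuclideanSpace ℝ (Fin 2)), IsFiniteMeasure μ ∧
      ∀ r : Fin 2 → ℤ, ∫ ξ, exp ((∑ i, (r i : ℝ) * ξ i : ℝ) * I) ∂μ = chargeOrbitCorr ω r :=
  (isPositiveDefinite_chargeOrbitCorr hω).exists_measure_integral_exp_eq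

/-- **Non-vacuity of the spin instances**: a representing finite measure of `spinOrbitCorr ω` EXISTS. -/
theorem spinOrbitCorr_representable (ω : InfVolFermionState 2) (hω : ω.IsTranslationInvariant) :
    ∃ μ : Measure (EuclideanSpace ℝ (Fin 2)), IsFiniteMeasure μ ∧
      ∀ r : Fin 2 → ℤ, ∫ ξ, exp ((∑ i, (r i : ℝ) * ξ i : ℝ) * I) ∂μ = spinOrbitCorr ω r :=
  (isPositiveDefinite_spinOrbitCorr hω).exists_measure_integral_exp_eq

/-- The torus-limit states of the rows are translation invariant (so the companions apply to them). -/
theorem rowState_representable {tp : ℝ} (ω : InfVolFermionState 2) {Ls : ℕ → ℕ} {ψ : ∀ L, Fock (Orb (FermionTorus 2 L))}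
    (hLs : Tendsto Ls atTop atTop)
    (hψ : ∀ j, IsGroundStateInSector (hubbardTorusTT' (Ls j) 1 tp 8) (rectN (7/8) (Ls j)) 0 (ψ (Ls j)))
    (hψ1 : ∀ j, star (ψ (Ls j)) ⬝ᵥ ψ (Ls j) = 1) (hlim : ω.IsTorusLimitOf ψ Ls) :
    (∃ μ : Measure (EuclideanSpace ℝ (Fin 2)), IsFiniteMeasure μ ∧
      ∀ r : Fin 2 → ℤ, ∫ ξ, exp ((∑ i, (r i : ℝ) * ξ i : ℝ) * I) ∂μ = chargeOrbitCorr ω r) ∧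
    (∃ μ : Measure (EuclideanSpace ℝ (Fin 2)), IsFiniteMeasure μ ∧
      ∀ r : Fin 2 → ℤ, ∫ ξ, exp ((∑ i, (r i : ℝ) * ξ i : ℝ) * I) ∂μ = spinOrbitCorr ω r) :=
  ⟨chargeOrbitCorr_representable ω (m3_rowState_invariances hLs hψ hψ1 hlim).1,
    spinOrbitCorr_representable ω (m3_rowState_invariances hLs hψ hψ1 hlim).1⟩

end Instances

end Summit.Ventures.CertifiedManyBodySolver.Certificates

end
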